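import Literature.MathematicalPhysics.QuantumLattice.TwistEaterIrreducibility
import HarnessLib

/-!
# A centre element of `SU(N)` carries an isolating twist iff it GENERATES the centre
# (Borel–Friedman–Morgan: rank-zero `c`-pairs exist only for `SU(n)` with `c` a generator)

Topic `Literature/MathematicalPhysics/QuantumLattice`; sequel of `TwistEaterIrreducibility.lean`, whose §4 proves the
positive half ★ `suCenter_isolatingTwist`: for `k` a UNIT of `ℤ/N` the centre element `z = ω^k·1` of `SU(N)`
(`ω = e^{2πi/N}`) has the three properties (i) `z` is a commutator `A B A⁻¹ B⁻¹`; (ii) all pairs with commutator `z`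
are simultaneously conjugate; (iii) every such pair has a FINITE simultaneous centraliser — literally the hypothesis
`HasIsolatingTwist (SU(N)) z` of the crux line `twisted-slab-continuity` (census row 43, anchor T1
`TwistedSlabAnchor`, which quantifies over «`G`, a central `z ≠ 1` of finite order with `HasIsolatingTwist G z`»).

This file proves the converse for type `A` and pins the scope of that binder:

* ★ `mem_center_specialUnitaryGroup_iff`: the centre of `SU(N)` is `Z_N = {ω^k·1 : k ∈ ℤ/N}` (a central element
  commutes with the clock–shift pair, whose commutant is the scalars by `exists_eq_smul_one_of_commute_pair`; a scalar
  of determinant one is an `N`-th root of unity);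
* ★ `exists_pair_infinite_centralizer_of_not_isUnit`: if `k` is NOT a unit of `ℤ/N` (this includes `k = 0`), there is
  a pair `A, B ∈ SU(N)` with `A B A⁻¹ B⁻¹ = ω^k·1` whose simultaneous centraliser is INFINITE.  Construction: with
  `g = gcd(k, N) ≥ 2`, `N = n·g`, `k = m·g`, the phase `ω_N^k = ω_n^m`, and `A = a ⊕ ⋯ ⊕ a`, `B = b ⊕ ⋯ ⊕ b` (`g` diagonal
  copies of an `SU(n)` pair `(a, b)` with commutator `ω_n^m·1`, re-indexed by `Fin N`) has commutator `ω^k·1`, while the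
  block-scalar torus `diag(ζ·1_n, ζ⁻¹·1_n, 1_n, …)`, `|ζ| = 1`, commutes with both — in the language of
  Borel–Friedman–Morgan the pair has POSITIVE RANK («`x` is of rank zero iff `Z(x)` is finite», op. cit. §2.1);
* ★ `exists_pairs_not_conj_of_not_isUnit`: for the same non-unit `k`, the pairs `(A, B)` and `(D·A, B)` (`D` one
  element of that torus with `ζ = e^{2πi/(n+1)}`) both have commutator `ω^k·1` and are NOT simultaneously conjugate
  (`Aⁿ` is scalar, so conjugacy would force `Dⁿ = 1`) — clause (ii) fails as well, clause (i) always holds;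
* ★ `suCenter_isolatingTwist_iff`: (i) ∧ (ii) ∧ (iii) for `ω^k·1` ⇔ `IsUnit k`; and ★ `isolating_central_iff`: an
  element `z ∈ SU(N)` is central with (i) ∧ (ii) ∧ (iii) iff `z = ω^k·1` for a unit `k` — so at `G = SU(N)` the binder
  of T1 ranges EXACTLY over the generators of `Z_N` (for `N ≥ 2` these are `≠ 1`, `suCenter_ne_one_of_isUnit`);
* §5 ★ `centralizer_pair_eq_zpowers_of_isUnit` ∕ `centralizer_pair_eq_center_of_isUnit`: for a UNIT `k` the
  simultaneous centraliser of every pair with commutator `ω^k·1` is exactly `⟨ω^k·1⟩ = Z(SU(N))` (Borel–Friedman–Morgan's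
  «`Z(x, y) = Z(G)`»), i.e. the sharpened clause (iii′) «centraliser `⊆ Subgroup.zpowers z`»; `zpowers_suCenter_finite`
  ((iii′) ⇒ (iii)) and ★ `suCenter_isolatingTwist_zpowers_iff`: (i) ∧ (ii) ∧ (iii′) ⇔ `IsUnit k`.

The general statement behind this (NOT typed here — the tree has no compact simply-connected simple Lie groups of the
other types as objects with their centres): for `G` compact, connected, simply connected and simple and `c ∈ Z(G)` of
order `> 1`, a `c`-pair `(x, y)`, `[x, y] = c`, with FINITE centraliser («rank zero») exists iff `G ≅ SU(n)` — more
generally a product of `SU(n_i)` — with `c` generating the centre (of each factor); then ALL `c`-pairs are conjugate and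
`Z(x, y) = Z(G)` [cite: BorelFriedmanMorgan2002, Prop 4.1.1] (arXiv:math/9907007 §4.1; the `SU(n)` pair is clock–shift,
Cor 4.1.2); the fixed torus `T^{w_c}` is finite iff every simple factor is `SU(n_i)` with `c_i` generating
[cite: BorelFriedmanMorgan2002, Prop 3.4.1]; in general the moduli space of `c`-pairs is
`(S̄^{w_c} × S̄^{w_c})/W(S^{w_c}, G)` [cite: BorelFriedmanMorgan2002, Thm 1.3.1] (after Schweigert, Nucl. Phys. B 492
(1997) 743) with `dim S^{w_c} = rank Φ(w_c) = #(⟨c⟩-orbits on the extended Dynkin diagram) − 1`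
[cite: BorelFriedmanMorgan2002, Thm 1.6.1], positive for `B_n`, `C_{n ≥ 2}`, `D_n`, `E₆` (`Φ(w_c) = G₂`), `E₇`
(`Φ(w_c) = F₄`) (closing table «Root systems on `t^{w_C}`» of op. cit.).  Hence, for simply-connected simple `G` and
central `z ≠ 1`, `HasIsolatingTwist G z` holds iff `G ≅ SU(N)` and `z` generates `Z_N`; this file is the type-`A`
part of «⇒» and, with `suCenter_isolatingTwist`, the whole of «⇐».
-- TODO(general form): the non-`A` types need the compact groups `Spin(n)`, `Sp(n)`, `E₆`, `E₇` with their centres.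

HONEST FRAMING: finite-dimensional linear algebra and a citation; a SCOPE remark on the binder of an open obligation
(T1), which is untouched (0/1); nothing here is a statement about a twisted partition function, purity, a femto-box
spectrum, `IRcof`/`IR`, or the Yang–Mills mass gap (Clay), which is NOT proved; `R4` closes only `BalabanLadder.UV`.

References: A. Borel, R. Friedman, J. W. Morgan, *Almost commuting elements in compact Lie groups*, Mem. Amer. Math.
Soc. 157 (2002) no. 747, arXiv:math/9907007 (corpus `paper:arxiv-math_9907007`: standing notation p0002 L33–34, §2.1
p0011 L32–36, Thm 1.3.1 p0004 L39–47, Thm 1.6.1 p0006 L62–85, Prop 3.4.1 p0017 L36–48, Prop 4.1.1 p0022 L16–36,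
Cor 4.1.2 p0022 L124–134, tables p0085 L25–48); A. González-Arroyo, *Yang–Mills fields on the four-dimensional torus*,
hep-th/9807108, §4.2; G. 't Hooft, Nucl. Phys. B 153 (1979) 141, §3.
-/

noncomputable section

open scoped Matrix

namespace Literature.MathematicalPhysics.QuantumLattice

variable {N : ℕ}

/-! ## §1 Group commutator versus the matrix relation `A B = ω^k · B A`; the centre of `SU(N)` is `Z_N` -/

section Centre

/-- The matrix of an `SU(N)` element is invertible (its conjugate transpose is the inverse). [folklore] -/
private theorem isUnit_val_specialUnitary (A : Matrix.specialUnitaryGroup (Fin N) ℂ) :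
    IsUnit (A : Matrix (Fin N) (Fin N) ℂ) :=
  ⟨⟨(A : Matrix (Fin N) (Fin N) ℂ), star (A : Matrix (Fin N) (Fin N) ℂ), A.prop.1.2, A.prop.1.1⟩, rfl⟩

/-- From the group commutator `A B A⁻¹ B⁻¹ = ω^k·1` to the matrix relation `A B = ω^k · B A`. [folklore] -/
private theorem val_mul_eq_smul_of_commutator_eq {k : ZMod N} {A B : Matrix.specialUnitaryGroup (Fin N) ℂ}
    (h : A * B * A⁻¹ * B⁻¹ = (suCenter N k : Matrix.specialUnitaryGroup (Fin N) ℂ)) :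
    (A : Matrix (Fin N) (Fin N) ℂ) * B = centerPhase N k • ((B : Matrix (Fin N) (Fin N) ℂ) * A) := by
  have h1 : A * B = (suCenter N k : Matrix.specialUnitaryGroup (Fin N) ℂ) * (B * A) := by
    rw [← h]; group
  have h2 := congrArg Subtype.val h1
  change (A : Matrix (Fin N) (Fin N) ℂ) * B =
    (centerPhase N k • (1 : Matrix (Fin N) (Fin N) ℂ)) * ((B : Matrix (Fin N) (Fin N) ℂ) * A) at h2
  rwa [Matrix.smul_mul, Matrix.one_mul] at h2

/-- From the matrix relation `A B = ω^k · B A` to the group commutator `A B A⁻¹ B⁻¹ = ω^k·1`. [folklore] -/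
private theorem commutator_eq_of_val_mul_eq_smul {k : ZMod N} {A B : Matrix.specialUnitaryGroup (Fin N) ℂ}
    (h : (A : Matrix (Fin N) (Fin N) ℂ) * B = centerPhase N k • ((B : Matrix (Fin N) (Fin N) ℂ) * A)) :
    A * B * A⁻¹ * B⁻¹ = (suCenter N k : Matrix.specialUnitaryGroup (Fin N) ℂ) := by
  have h1 : A * B = (suCenter N k : Matrix.specialUnitaryGroup (Fin N) ℂ) * (B * A) := by
    apply Subtype.ext
    change (A : Matrix (Fin N) (Fin N) ℂ) * B =
      (centerPhase N k • (1 : Matrix (Fin N) (Fin N) ℂ)) * ((B : Matrix (Fin N) (Fin N) ℂ) * A)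
    rw [Matrix.smul_mul, Matrix.one_mul]
    exact h
  rw [h1]; group

/-- ★ **The centre of `SU(N)` is `Z_N`**: an element of `SU(N)` is central iff it is one of the scalar matrices
`ω^k·1`, `k ∈ ℤ/N` (a central element commutes with 't Hooft's clock–shift pair, whose commutant consists of the
scalars; a scalar of determinant `1` is an `N`-th root of unity).  This identifies the range of the binder «`z` central»
of the twisted-box constructions at `G = SU(N)`. [cite: Gonzalezarroyo1998, §4.2] [cite: tHooft1979Flux, §2 (2.2)] -/
theorem mem_center_specialUnitaryGroup_iff [NeZero N] (z : Matrix.specialUnitaryGroup (Fin N) ℂ) :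
    z ∈ Subgroup.center (Matrix.specialUnitaryGroup (Fin N) ℂ) ↔
      ∃ k : ZMod N, z = (suCenter N k : Matrix.specialUnitaryGroup (Fin N) ℂ) := by
  classical
  constructor
  · intro hz
    obtain ⟨A, B, hAB⟩ := exists_pair_commutator_eq_suCenter (N := N) (1 : ZMod N)
    have hABm := val_mul_eq_smul_of_commutator_eq hAB
    have hzA : (z : Matrix (Fin N) (Fin N) ℂ) * A = (A : Matrix (Fin N) (Fin N) ℂ) * z :=
      congrArg Subtype.val ((Subgroup.mem_center_iff.1 hz A).symm)
    have hzB : (z : Matrix (Fin N) (Fin N) ℂ) * B = (B : Matrix (Fin N) (Fin N) ℂ) * z :=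
      congrArg Subtype.val ((Subgroup.mem_center_iff.1 hz B).symm)
    obtain ⟨c, hc⟩ := exists_eq_smul_one_of_commute_pair (isUnit_val_specialUnitary A)
      (isUnit_val_specialUnitary B) (isPrimitiveRoot_centerPhase N isUnit_one) hABm hzA hzB
    have hdet : (z : Matrix (Fin N) (Fin N) ℂ).det = 1 := (Matrix.mem_specialUnitaryGroup_iff.1 z.prop).2
    rw [hc, Matrix.det_smul, Matrix.det_one, mul_one, Fintype.card_fin] at hdet
    obtain ⟨i, hi, hci⟩ := (Complex.isPrimitiveRoot_exp N (NeZero.ne N)).eq_pow_of_pow_eq_one hdet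
    refine ⟨(i : ZMod N), Subtype.ext ?_⟩
    rw [coe_suCenter, hc, ← hci, centerPhase_eq_exp_pow, ZMod.val_natCast, Nat.mod_eq_of_lt hi]
  · rintro ⟨k, rfl⟩
    exact (suCenter N k).2

end Centre

/-! ## §2 Diagonal copies `d₀ ⊕ ⋯ ⊕ d_{g−1}` of `n × n` blocks, re-indexed by `Fin N` (`N = n·g`) -/

section Copies

variable {n g : ℕ} (e : Fin N ≃ Fin n × Fin g)

/-- Block products: `(⊕ d_c)(⊕ d'_c) = ⊕ (d_c d'_c)`. [folklore] -/
private theorem copies_mul (d d' : Fin g → Matrix (Fin n) (Fin n) ℂ) :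
    (Matrix.blockDiagonal d).submatrix e e * (Matrix.blockDiagonal d').submatrix e e =
      (Matrix.blockDiagonal fun c => d c * d' c).submatrix e e := by
  rw [Matrix.submatrix_mul_equiv, Matrix.blockDiagonal_mul]

/-- Block adjoints: `(⊕ d_c)ᴴ = ⊕ d_cᴴ`. [folklore] -/
private theorem copies_conjTranspose (d : Fin g → Matrix (Fin n) (Fin n) ℂ) :
    ((Matrix.blockDiagonal d).submatrix e e)ᴴ = (Matrix.blockDiagonal fun c => (d c)ᴴ).submatrix e e := by
  rw [Matrix.conjTranspose_submatrix, Matrix.blockDiagonal_conjTranspose]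

/-- `⊕ 1 = 1`. [folklore] -/
private theorem copies_one :
    (Matrix.blockDiagonal fun _ : Fin g => (1 : Matrix (Fin n) (Fin n) ℂ)).submatrix e e = 1 := by
  have h : (fun _ : Fin g => (1 : Matrix (Fin n) (Fin n) ℂ)) = 1 := rfl
  rw [h, Matrix.blockDiagonal_one, Matrix.submatrix_one_equiv]

/-- Scalars pull out of the blocks. [folklore] -/
private theorem copies_smul (x : ℂ) (d : Fin g → Matrix (Fin n) (Fin n) ℂ) :
    (Matrix.blockDiagonal fun c => x • d c).submatrix e e = x • (Matrix.blockDiagonal d).submatrix e e := by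
  have h : (fun c => x • d c) = x • d := rfl
  rw [h, Matrix.blockDiagonal_smul]
  rfl

/-- Unitary blocks give a unitary matrix. [folklore] -/
private theorem copies_mem_unitaryGroup {d : Fin g → Matrix (Fin n) (Fin n) ℂ}
    (hd : ∀ c, d c ∈ Matrix.unitaryGroup (Fin n) ℂ) :
    (Matrix.blockDiagonal d).submatrix e e ∈ Matrix.unitaryGroup (Fin N) ℂ := by
  rw [Matrix.mem_unitaryGroup_iff, Matrix.star_eq_conjTranspose, copies_conjTranspose, copies_mul]
  have h : (fun c => d c * (d c)ᴴ) = fun _ => (1 : Matrix (Fin n) (Fin n) ℂ) := by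
    funext c
    have h1 := Matrix.mem_unitaryGroup_iff.1 (hd c)
    rwa [Matrix.star_eq_conjTranspose] at h1
  rw [h, copies_one]

/-- The determinant is the product of the block determinants. [folklore] -/
private theorem det_copies (d : Fin g → Matrix (Fin n) (Fin n) ℂ) :
    ((Matrix.blockDiagonal d).submatrix e e).det = ∏ c, (d c).det := by
  rw [Matrix.det_submatrix_equiv_self, Matrix.det_blockDiagonal]

/-- Unitary blocks with `∏ det = 1` give an element of `SU(N)`. [folklore] -/
private theorem copies_mem_specialUnitaryGroup {d : Fin g → Matrix (Fin n) (Fin n) ℂ}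
    (hd : ∀ c, d c ∈ Matrix.unitaryGroup (Fin n) ℂ) (hdet : ∏ c, (d c).det = 1) :
    (Matrix.blockDiagonal d).submatrix e e ∈ Matrix.specialUnitaryGroup (Fin N) ℂ :=
  Matrix.mem_specialUnitaryGroup_iff.2 ⟨copies_mem_unitaryGroup e hd, by rw [det_copies, hdet]⟩

/-- Diagonal entries of the `c`-th block. [folklore] -/
private theorem copies_apply (d : Fin g → Matrix (Fin n) (Fin n) ℂ) (i j : Fin n) (c : Fin g) :
    (Matrix.blockDiagonal d).submatrix e e (e.symm (i, c)) (e.symm (j, c)) = d c i j := by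
  rw [Matrix.submatrix_apply, Equiv.apply_symm_apply, Equiv.apply_symm_apply, Matrix.blockDiagonal_apply_eq]

/-- A scalar of modulus one is a unitary matrix. [folklore] -/
private theorem smul_one_mem_unitaryGroup {x : ℂ} (hx : ‖x‖ = 1) :
    x • (1 : Matrix (Fin n) (Fin n) ℂ) ∈ Matrix.unitaryGroup (Fin n) ℂ := by
  rw [Matrix.mem_unitaryGroup_iff, Matrix.star_eq_conjTranspose, Matrix.conjTranspose_smul,
    Matrix.conjTranspose_one, Matrix.smul_mul, Matrix.one_mul, smul_smul]
  have h : x * star x = 1 := by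
    rw [Complex.star_def, Complex.mul_conj, Complex.normSq_eq_norm_sq, hx]
    norm_num
  rw [h, one_smul]

/-- Block powers: `(⊕ d_c)^i = ⊕ d_c^i`. [folklore] -/
private theorem copies_pow (d : Fin g → Matrix (Fin n) (Fin n) ℂ) (i : ℕ) :
    ((Matrix.blockDiagonal d).submatrix e e) ^ i = (Matrix.blockDiagonal fun c => d c ^ i).submatrix e e := by
  induction i with
  | zero => simp_rw [pow_zero]; rw [copies_one]
  | succ i ih => rw [pow_succ, ih, copies_mul]; simp_rw [pow_succ]

/-- **Block scalars** `⊕ δ_c·1` with `|δ_c| = 1` and `∏ δ_c = 1` lie in `SU(N)`. [folklore] -/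
private theorem blockScalar_mem_specialUnitaryGroup {δ : Fin g → ℂ} (hδ : ∀ c, ‖δ c‖ = 1) (hprod : ∏ c, δ c = 1) :
    (Matrix.blockDiagonal fun c => δ c • (1 : Matrix (Fin n) (Fin n) ℂ)).submatrix e e ∈
      Matrix.specialUnitaryGroup (Fin N) ℂ :=
  copies_mem_specialUnitaryGroup e (fun c => smul_one_mem_unitaryGroup (hδ c)) (by
    simp_rw [Matrix.det_smul, Matrix.det_one, mul_one, Fintype.card_fin, Finset.prod_pow, hprod, one_pow])

/-- Block scalars commute with diagonal copies `x ⊕ ⋯ ⊕ x`. [folklore] -/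
private theorem blockScalar_mul_copies (δ : Fin g → ℂ) (x : Matrix (Fin n) (Fin n) ℂ) :
    (Matrix.blockDiagonal fun c => δ c • (1 : Matrix (Fin n) (Fin n) ℂ)).submatrix e e *
        (Matrix.blockDiagonal fun _ : Fin g => x).submatrix e e =
      (Matrix.blockDiagonal fun _ : Fin g => x).submatrix e e *
        (Matrix.blockDiagonal fun c => δ c • (1 : Matrix (Fin n) (Fin n) ℂ)).submatrix e e := by
  rw [copies_mul, copies_mul]
  simp only [Matrix.smul_mul, Matrix.one_mul, Matrix.mul_smul, Matrix.mul_one]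

/-- The diagonal entries of a block scalar. [folklore] -/
private theorem blockScalar_apply (δ : Fin g → ℂ) (i : Fin n) (c : Fin g) :
    (Matrix.blockDiagonal fun c => δ c • (1 : Matrix (Fin n) (Fin n) ℂ)).submatrix e e (e.symm (i, c))
      (e.symm (i, c)) = δ c := by
  rw [copies_apply, Matrix.smul_apply, Matrix.one_apply_eq, smul_eq_mul, mul_one]

/-- Powers of a block scalar. [folklore] -/
private theorem blockScalar_pow (δ : Fin g → ℂ) (i : ℕ) :
    ((Matrix.blockDiagonal fun c => δ c • (1 : Matrix (Fin n) (Fin n) ℂ)).submatrix e e) ^ i =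
      (Matrix.blockDiagonal fun c => δ c ^ i • (1 : Matrix (Fin n) (Fin n) ℂ)).submatrix e e := by
  rw [copies_pow]
  simp_rw [smul_pow, one_pow]

/-- The two-point block scalar `(ζ, ζ⁻¹, 1, …, 1)`: entries of modulus one, product one, first entry `ζ`. [folklore] -/
private theorem twoPoint_props {c0 c1 : Fin g} (h01 : c1 ≠ c0) {ζ : ℂ} (hζ1 : ‖ζ‖ = 1) (hζ0 : ζ ≠ 0) :
    (∀ c, ‖Function.update (Function.update (fun _ : Fin g => (1 : ℂ)) c1 ζ⁻¹) c0 ζ c‖ = 1) ∧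
    (∏ c, Function.update (Function.update (fun _ : Fin g => (1 : ℂ)) c1 ζ⁻¹) c0 ζ c = 1) ∧
    Function.update (Function.update (fun _ : Fin g => (1 : ℂ)) c1 ζ⁻¹) c0 ζ c0 = ζ := by
  classical
  refine ⟨fun c => ?_, ?_, ?_⟩
  · simp only [Function.update_apply]
    split_ifs
    · exact hζ1
    · rw [norm_inv, hζ1, inv_one]
    · exact norm_one
  · rw [Finset.prod_update_of_mem (Finset.mem_univ c0),
      Finset.prod_update_of_mem (Finset.mem_sdiff.2 ⟨Finset.mem_univ c1, by simpa using h01⟩),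
      Finset.prod_const_one, mul_one, mul_inv_cancel₀ hζ0]
  · rw [Function.update_apply, if_pos rfl]

end Copies

/-! ## §3 A non-generating centre element has a pair with INFINITE centraliser (positive rank) and pairs that are
NOT conjugate -/

section NonGenerating

/-- **Set-up for a non-generating `k`.**  If `k` is not a unit of `ℤ/N` then, with `g = gcd(k, N) ≥ 2` and `N = n·g`,
there are a re-indexing `Fin N ≃ Fin n × Fin g` and a pair `a, b ∈ SU(n)` with `a b = ω_N^k · b a`, the phase `ω_N^k`
being a PRIMITIVE `n`-th root of unity (`ω_N^k = ω_n^{k/g}`, `k/g` coprime to `n`). [folklore] -/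
private theorem nonGenerating_setup [NeZero N] {k : ZMod N} (hk : ¬IsUnit k) :
    ∃ (n g : ℕ) (_ : Fin N ≃ Fin n × Fin g) (a b : Matrix.specialUnitaryGroup (Fin n) ℂ),
      2 ≤ g ∧ 0 < n ∧
      (a : Matrix (Fin n) (Fin n) ℂ) * b = centerPhase N k • ((b : Matrix (Fin n) (Fin n) ℂ) * a) ∧
      IsPrimitiveRoot (centerPhase N k) n := by
  classical
  -- arithmetic: `g = gcd(k, N) ≥ 2`, `N = g·n`, `k = g·m`, `m < n`, `m` coprime to `n`
  have hN0 : 0 < N := Nat.pos_of_ne_zero (NeZero.ne N)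
  obtain ⟨g, hgdef⟩ : ∃ g, g = Nat.gcd k.val N := ⟨_, rfl⟩
  have hg1 : g ≠ 1 := by
    intro h1
    apply hk
    rw [← ZMod.natCast_zmod_val k, ZMod.isUnit_iff_coprime]
    rw [hgdef] at h1
    exact h1
  have hgpos : 0 < g := by rw [hgdef]; exact Nat.gcd_pos_of_pos_right _ hN0
  have hg2 : 2 ≤ g := by omega
  obtain ⟨n, hn⟩ : g ∣ N := by rw [hgdef]; exact Nat.gcd_dvd_right k.val N
  obtain ⟨m, hm⟩ : g ∣ k.val := by rw [hgdef]; exact Nat.gcd_dvd_left k.val N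
  have hnpos : 0 < n := by
    rcases Nat.eq_zero_or_pos n with h | h
    · rw [h, mul_zero] at hn; omega
    · exact h
  haveI : NeZero n := ⟨hnpos.ne'⟩
  have hmn : m < n := by
    have h := ZMod.val_lt k
    rw [hm, hn] at h
    exact Nat.lt_of_mul_lt_mul_left h
  have hcop : Nat.Coprime m n := by
    have h := Nat.coprime_div_gcd_div_gcd (m := k.val) (n := N) (by rw [← hgdef]; exact hgpos)
    rwa [← hgdef, hm, hn, Nat.mul_div_cancel_left m hgpos, Nat.mul_div_cancel_left n hgpos] at h
  have hNe : N = n * g := by rw [hn, mul_comm]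
  -- the phases agree: `ω_n^m = ω_N^k`
  have hphase : centerPhase n (m : ZMod n) = centerPhase N k := by
    have h1 : (((m : ZMod n).val : ℕ) : ℝ) = m := by rw [ZMod.val_natCast, Nat.mod_eq_of_lt hmn]
    have h2 : ((k.val : ℕ) : ℝ) = g * m := by rw [hm]; push_cast; ring
    have h3 : ((N : ℕ) : ℝ) = g * n := by rw [hn]; push_cast; ring
    have hg0 : (g : ℝ) ≠ 0 := by exact_mod_cast hgpos.ne'
    have hn0 : (n : ℝ) ≠ 0 := by exact_mod_cast hnpos.ne'
    have h4 : (2 * Real.pi * (((m : ZMod n).val : ℕ) : ℝ) / n : ℝ) = 2 * Real.pi * ((k.val : ℕ) : ℝ) / N := by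
      rw [h1, h2, h3]
      field_simp
    rw [centerPhase, centerPhase, h4]
  -- the small pair in `SU(n)`
  obtain ⟨a, b, hab⟩ := exists_pair_commutator_eq_suCenter (N := n) (m : ZMod n)
  refine ⟨n, g, (finCongr hNe).trans finProdFinEquiv.symm, a, b, hg2, hnpos, ?_, ?_⟩
  · rw [← hphase]
    exact val_mul_eq_smul_of_commutator_eq hab
  · rw [← hphase]
    exact isPrimitiveRoot_centerPhase n ((ZMod.isUnit_iff_coprime m n).2 hcop)

/-- ★ **Non-generating twists are not isolating.**  If `k` is NOT a unit of `ℤ/N` (`gcd(k, N) = g ≥ 2`; `k = 0`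
allowed), there are `A, B ∈ SU(N)` with `A B A⁻¹ B⁻¹ = ω^k·1` whose simultaneous centraliser is infinite: `A`, `B`
are `g` diagonal copies of an `SU(N/g)` pair with commutator `ω_{N/g}^{k/g}·1` and the block-scalar torus
`diag(ζ·1, ζ⁻¹·1, 1, …, 1)`, `|ζ| = 1`, centralises them.  Contrapositive, for `SU(n)`, of «if `(x, y)` is a `c`-pair
of rank zero then … `c` generates the centre» — a non-generating `c` has only pairs of positive rank.
[cite: BorelFriedmanMorgan2002, Prop 4.1.1] [cite: Gonzalezarroyo1998, §4.2] -/
theorem exists_pair_infinite_centralizer_of_not_isUnit [NeZero N] {k : ZMod N} (hk : ¬IsUnit k) :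
    ∃ A B : Matrix.specialUnitaryGroup (Fin N) ℂ,
      A * B * A⁻¹ * B⁻¹ = (suCenter N k : Matrix.specialUnitaryGroup (Fin N) ℂ) ∧
      {x : Matrix.specialUnitaryGroup (Fin N) ℂ | x * A * x⁻¹ = A ∧ x * B * x⁻¹ = B}.Infinite := by
  classical
  obtain ⟨n, g, e, a, b, hg2, hnpos, habm, -⟩ := nonGenerating_setup hk
  have hau : (a : Matrix (Fin n) (Fin n) ℂ) ∈ Matrix.unitaryGroup (Fin n) ℂ := a.prop.1
  have hbu : (b : Matrix (Fin n) (Fin n) ℂ) ∈ Matrix.unitaryGroup (Fin n) ℂ := b.prop.1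
  have hadet : (a : Matrix (Fin n) (Fin n) ℂ).det = 1 := (Matrix.mem_specialUnitaryGroup_iff.1 a.prop).2
  have hbdet : (b : Matrix (Fin n) (Fin n) ℂ).det = 1 := (Matrix.mem_specialUnitaryGroup_iff.1 b.prop).2
  -- the big pair: `g` diagonal copies
  have hAmem : (Matrix.blockDiagonal fun _ : Fin g => (a : Matrix (Fin n) (Fin n) ℂ)).submatrix e e ∈
      Matrix.specialUnitaryGroup (Fin N) ℂ :=
    copies_mem_specialUnitaryGroup e (fun _ => hau) (by simp [hadet])
  have hBmem : (Matrix.blockDiagonal fun _ : Fin g => (b : Matrix (Fin n) (Fin n) ℂ)).submatrix e e ∈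
      Matrix.specialUnitaryGroup (Fin N) ℂ :=
    copies_mem_specialUnitaryGroup e (fun _ => hbu) (by simp [hbdet])
  refine ⟨⟨_, hAmem⟩, ⟨_, hBmem⟩, ?_, ?_⟩
  · -- commutator
    apply commutator_eq_of_val_mul_eq_smul
    change (Matrix.blockDiagonal fun _ : Fin g => (a : Matrix (Fin n) (Fin n) ℂ)).submatrix e e *
        (Matrix.blockDiagonal fun _ : Fin g => (b : Matrix (Fin n) (Fin n) ℂ)).submatrix e e =
      centerPhase N k • ((Matrix.blockDiagonal fun _ : Fin g => (b : Matrix (Fin n) (Fin n) ℂ)).submatrix e e *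
        (Matrix.blockDiagonal fun _ : Fin g => (a : Matrix (Fin n) (Fin n) ℂ)).submatrix e e)
    rw [copies_mul, copies_mul, ← copies_smul]
    simp_rw [habm]
  · -- the centralising torus `t ↦ diag(ζ_t·1, ζ_t⁻¹·1, 1, …, 1)`, `ζ_t = e^{2πi/(t+1)}`
    obtain ⟨c0, hc0⟩ : ∃ c : Fin g, c.val = 0 := ⟨⟨0, by omega⟩, rfl⟩
    obtain ⟨c1, hc1⟩ : ∃ c : Fin g, c.val = 1 := ⟨⟨1, by omega⟩, rfl⟩
    have hc01 : c1 ≠ c0 := by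
      intro h
      have h' := congrArg Fin.val h
      rw [hc0, hc1] at h'
      exact one_ne_zero h'
    obtain ⟨i0, -⟩ : ∃ _ : Fin n, True := ⟨⟨0, hnpos⟩, trivial⟩
    obtain ⟨ζ, hζdef⟩ : ∃ ζ : ℕ → ℂ, ∀ t, ζ t = Complex.exp (2 * Real.pi * Complex.I / ((t + 1 : ℕ) : ℂ)) :=
      ⟨_, fun _ => rfl⟩
    have hζ : ∀ t, IsPrimitiveRoot (ζ t) (t + 1) := fun t => by
      rw [hζdef]; exact Complex.isPrimitiveRoot_exp (t + 1) (Nat.succ_ne_zero t)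
    have hζnorm : ∀ t, ‖ζ t‖ = 1 := fun t => (hζ t).norm'_eq_one (Nat.succ_ne_zero t)
    have hζne : ∀ t, ζ t ≠ 0 := fun t => (hζ t).ne_zero (Nat.succ_ne_zero t)
    -- the block scalars
    obtain ⟨δ, hδdef⟩ : ∃ δ : ℕ → Fin g → ℂ,
        ∀ t, δ t = Function.update (Function.update (fun _ => (1 : ℂ)) c1 (ζ t)⁻¹) c0 (ζ t) := ⟨_, fun _ => rfl⟩
    have hδ : ∀ t, (∀ c, ‖δ t c‖ = 1) ∧ (∏ c, δ t c = 1) ∧ δ t c0 = ζ t := fun t => by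
      rw [hδdef]; exact twoPoint_props hc01 (hζnorm t) (hζne t)
    obtain ⟨D, hDdef⟩ : ∃ D : ℕ → Matrix.specialUnitaryGroup (Fin N) ℂ,
        ∀ t, D t = ⟨_, blockScalar_mem_specialUnitaryGroup e (hδ t).1 (hδ t).2.1⟩ := ⟨_, fun _ => rfl⟩
    have hDval : ∀ t, (D t : Matrix (Fin N) (Fin N) ℂ) =
        (Matrix.blockDiagonal fun c => δ t c • (1 : Matrix (Fin n) (Fin n) ℂ)).submatrix e e := fun t => by
      rw [hDdef]
    -- the corner entry recovers `ζ_t`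
    have hkey : ∀ t, (D t : Matrix (Fin N) (Fin N) ℂ) (e.symm (i0, c0)) (e.symm (i0, c0)) = ζ t := by
      intro t
      rw [hDval, blockScalar_apply, (hδ t).2.2]
    refine Set.infinite_of_injective_forall_mem (f := D) ?_ ?_
    · intro s t hst
      have h := congrArg
        (fun x : Matrix.specialUnitaryGroup (Fin N) ℂ => (x : Matrix (Fin N) (Fin N) ℂ) (e.symm (i0, c0))
          (e.symm (i0, c0))) hst
      simp only [hkey] at h
      have hs := hζ s
      rw [h] at hs
      have hst' : s + 1 = t + 1 := hs.unique (hζ t)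
      omega
    · intro t
      refine ⟨?_, ?_⟩
      · rw [mul_inv_eq_iff_eq_mul]
        apply Subtype.ext
        change (D t : Matrix (Fin N) (Fin N) ℂ) * _ = _ * (D t : Matrix (Fin N) (Fin N) ℂ)
        rw [hDval, blockScalar_mul_copies]
      · rw [mul_inv_eq_iff_eq_mul]
        apply Subtype.ext
        change (D t : Matrix (Fin N) (Fin N) ℂ) * _ = _ * (D t : Matrix (Fin N) (Fin N) ℂ)
        rw [hDval, blockScalar_mul_copies]

/-- ★ **For a non-generating twist the pairs are NOT all conjugate** (clause (ii) fails as well): if `k` is not a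
unit of `ℤ/N` there are two pairs `(A, B)`, `(A', B')` in `SU(N)`, both with commutator `ω^k·1`, that are not
simultaneously conjugate — indeed `A' = D·A` with `D = diag(ζ·1, ζ⁻¹·1, 1, …)` a block scalar, `ζ = e^{2πi/(n+1)}`,
`n = N/gcd(k, N)`, is not even conjugate to `A`: `Aⁿ` is the scalar `α·1` (powers of a Weyl pair), so conjugacy would
force `(D A)ⁿ = Dⁿ Aⁿ = Aⁿ`, `Dⁿ = 1`, `ζⁿ = 1`.  For `SU(n)` with a non-generating `c` the moduli space of `c`-pairs
has positive dimension («all `c`-pairs in `G` are conjugate» is item 5 of the rank-zero case only).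
[cite: BorelFriedmanMorgan2002, Prop 4.1.1] [cite: BorelFriedmanMorgan2002, Thm 1.3.1] -/
theorem exists_pairs_not_conj_of_not_isUnit [NeZero N] {k : ZMod N} (hk : ¬IsUnit k) :
    ∃ A B A' B' : Matrix.specialUnitaryGroup (Fin N) ℂ,
      A * B * A⁻¹ * B⁻¹ = (suCenter N k : Matrix.specialUnitaryGroup (Fin N) ℂ) ∧
      A' * B' * A'⁻¹ * B'⁻¹ = (suCenter N k : Matrix.specialUnitaryGroup (Fin N) ℂ) ∧
      ¬ ∃ h : Matrix.specialUnitaryGroup (Fin N) ℂ, A' = h * A * h⁻¹ ∧ B' = h * B * h⁻¹ := by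
  classical
  obtain ⟨n, g, e, a, b, hg2, hnpos, habm, hprim⟩ := nonGenerating_setup hk
  haveI : NeZero n := ⟨hnpos.ne'⟩
  have hau : (a : Matrix (Fin n) (Fin n) ℂ) ∈ Matrix.unitaryGroup (Fin n) ℂ := a.prop.1
  have hbu : (b : Matrix (Fin n) (Fin n) ℂ) ∈ Matrix.unitaryGroup (Fin n) ℂ := b.prop.1
  have hadet : (a : Matrix (Fin n) (Fin n) ℂ).det = 1 := (Matrix.mem_specialUnitaryGroup_iff.1 a.prop).2
  have hbdet : (b : Matrix (Fin n) (Fin n) ℂ).det = 1 := (Matrix.mem_specialUnitaryGroup_iff.1 b.prop).2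
  -- the big pair
  have hAmem : (Matrix.blockDiagonal fun _ : Fin g => (a : Matrix (Fin n) (Fin n) ℂ)).submatrix e e ∈
      Matrix.specialUnitaryGroup (Fin N) ℂ :=
    copies_mem_specialUnitaryGroup e (fun _ => hau) (by simp [hadet])
  have hBmem : (Matrix.blockDiagonal fun _ : Fin g => (b : Matrix (Fin n) (Fin n) ℂ)).submatrix e e ∈
      Matrix.specialUnitaryGroup (Fin N) ℂ :=
    copies_mem_specialUnitaryGroup e (fun _ => hbu) (by simp [hbdet])
  obtain ⟨A, hAdef⟩ : ∃ A : Matrix.specialUnitaryGroup (Fin N) ℂ, A = ⟨_, hAmem⟩ := ⟨_, rfl⟩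
  obtain ⟨B, hBdef⟩ : ∃ B : Matrix.specialUnitaryGroup (Fin N) ℂ, B = ⟨_, hBmem⟩ := ⟨_, rfl⟩
  have hAval : (A : Matrix (Fin N) (Fin N) ℂ) =
      (Matrix.blockDiagonal fun _ : Fin g => (a : Matrix (Fin n) (Fin n) ℂ)).submatrix e e := by rw [hAdef]
  have hBval : (B : Matrix (Fin N) (Fin N) ℂ) =
      (Matrix.blockDiagonal fun _ : Fin g => (b : Matrix (Fin n) (Fin n) ℂ)).submatrix e e := by rw [hBdef]
  have hABm : (A : Matrix (Fin N) (Fin N) ℂ) * B = centerPhase N k • ((B : Matrix (Fin N) (Fin N) ℂ) * A) := by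
    rw [hAval, hBval, copies_mul, copies_mul, ← copies_smul]
    simp_rw [habm]
  -- one block scalar `D = diag(ζ·1, ζ⁻¹·1, 1, …)` with `ζ` a primitive `(n+1)`-th root of unity
  obtain ⟨c0, hc0⟩ : ∃ c : Fin g, c.val = 0 := ⟨⟨0, by omega⟩, rfl⟩
  obtain ⟨c1, hc1⟩ : ∃ c : Fin g, c.val = 1 := ⟨⟨1, by omega⟩, rfl⟩
  have hc01 : c1 ≠ c0 := by
    intro h
    have h' := congrArg Fin.val h
    rw [hc0, hc1] at h'
    exact one_ne_zero h'
  obtain ⟨i0, -⟩ : ∃ _ : Fin n, True := ⟨⟨0, hnpos⟩, trivial⟩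
  obtain ⟨ζ, hζdef⟩ : ∃ ζ : ℂ, ζ = Complex.exp (2 * Real.pi * Complex.I / ((n + 1 : ℕ) : ℂ)) := ⟨_, rfl⟩
  have hζ : IsPrimitiveRoot ζ (n + 1) := by
    rw [hζdef]; exact Complex.isPrimitiveRoot_exp (n + 1) (Nat.succ_ne_zero n)
  have hζnorm : ‖ζ‖ = 1 := hζ.norm'_eq_one (Nat.succ_ne_zero n)
  have hζne : ζ ≠ 0 := hζ.ne_zero (Nat.succ_ne_zero n)
  obtain ⟨δ, hδdef⟩ : ∃ δ : Fin g → ℂ,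
      δ = Function.update (Function.update (fun _ => (1 : ℂ)) c1 ζ⁻¹) c0 ζ := ⟨_, rfl⟩
  have hδ : (∀ c, ‖δ c‖ = 1) ∧ (∏ c, δ c = 1) ∧ δ c0 = ζ := by
    rw [hδdef]; exact twoPoint_props hc01 hζnorm hζne
  obtain ⟨D, hDdef⟩ : ∃ D : Matrix.specialUnitaryGroup (Fin N) ℂ,
      D = ⟨_, blockScalar_mem_specialUnitaryGroup e hδ.1 hδ.2.1⟩ := ⟨_, rfl⟩
  have hDval : (D : Matrix (Fin N) (Fin N) ℂ) =
      (Matrix.blockDiagonal fun c => δ c • (1 : Matrix (Fin n) (Fin n) ℂ)).submatrix e e := by rw [hDdef]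
  have hDA : D * A = A * D := by
    apply Subtype.ext
    change (D : Matrix (Fin N) (Fin N) ℂ) * A = (A : Matrix (Fin N) (Fin N) ℂ) * D
    rw [hDval, hAval, blockScalar_mul_copies]
  have hDB : D * B = B * D := by
    apply Subtype.ext
    change (D : Matrix (Fin N) (Fin N) ℂ) * B = (B : Matrix (Fin N) (Fin N) ℂ) * D
    rw [hDval, hBval, blockScalar_mul_copies]
  refine ⟨A, B, D * A, B, commutator_eq_of_val_mul_eq_smul hABm, ?_, ?_⟩
  · -- the second pair has the same commutator (D commutes with both)
    apply commutator_eq_of_val_mul_eq_smul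
    have hDBm : (D : Matrix (Fin N) (Fin N) ℂ) * B = (B : Matrix (Fin N) (Fin N) ℂ) * D :=
      congrArg Subtype.val hDB
    change (D : Matrix (Fin N) (Fin N) ℂ) * A * B =
      centerPhase N k • ((B : Matrix (Fin N) (Fin N) ℂ) * ((D : Matrix (Fin N) (Fin N) ℂ) * A))
    rw [mul_assoc, hABm, Matrix.mul_smul, ← mul_assoc, hDBm, mul_assoc]
  · -- `D A` is not conjugate to `A`
    rintro ⟨h, hA', -⟩
    -- `Aⁿ` is a scalar matrix
    obtain ⟨α, -, hα⟩ := exists_pow_card_eq_smul_one (isUnit_val_specialUnitary a) (isUnit_val_specialUnitary b)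
      hprim habm
    have hAn : ((A ^ n : Matrix.specialUnitaryGroup (Fin N) ℂ) : Matrix (Fin N) (Fin N) ℂ) =
        α • (1 : Matrix (Fin N) (Fin N) ℂ) := by
      rw [SubmonoidClass.coe_pow, hAval, copies_pow]
      simp_rw [hα]
      rw [copies_smul, copies_one]
    -- hence central: `h Aⁿ h⁻¹ = Aⁿ`
    have hcen : h * A ^ n * h⁻¹ = A ^ n := by
      rw [mul_inv_eq_iff_eq_mul]
      apply Subtype.ext
      change (h : Matrix (Fin N) (Fin N) ℂ) * ((A ^ n : Matrix.specialUnitaryGroup (Fin N) ℂ) : Matrix _ _ ℂ) =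
        ((A ^ n : Matrix.specialUnitaryGroup (Fin N) ℂ) : Matrix (Fin N) (Fin N) ℂ) * (h : Matrix (Fin N) (Fin N) ℂ)
      rw [hAn, Matrix.mul_smul, Matrix.mul_one, Matrix.smul_mul, Matrix.one_mul]
    -- `(D A)ⁿ = h Aⁿ h⁻¹ = Aⁿ` and `(D A)ⁿ = Dⁿ Aⁿ`, so `Dⁿ = 1`
    have hpow : (D * A) ^ n = A ^ n := by rw [hA', conj_pow, hcen]
    have hc : Commute D A := hDA
    rw [hc.mul_pow] at hpow
    have hDn : D ^ n = 1 := mul_right_cancel (hpow.trans (one_mul (A ^ n)).symm)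
    -- read off the corner entry: `ζⁿ = 1`, contradicting primitivity of order `n + 1 > n`
    have hval := congrArg (fun x : Matrix.specialUnitaryGroup (Fin N) ℂ =>
      (x : Matrix (Fin N) (Fin N) ℂ) (e.symm (i0, c0)) (e.symm (i0, c0))) hDn
    simp only [SubmonoidClass.coe_pow, OneMemClass.coe_one, Matrix.one_apply_eq] at hval
    rw [hDval, blockScalar_pow, blockScalar_apply, hδ.2.2] at hval
    have hdvd : n + 1 ∣ n := (hζ.pow_eq_one_iff_dvd n).1 hval
    exact absurd (Nat.le_of_dvd hnpos hdvd) (by omega)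

end NonGenerating

/-! ## §4 The isolating twists of `SU(N)` are exactly the generators of `Z_N` -/

section Iff

/-- ★ **A centre element of `SU(N)` carries an isolating twist iff it generates the centre**: for `z = ω^k·1` the
conjunction «(i) `z` is a commutator ∧ (ii) all pairs with commutator `z` are simultaneously conjugate ∧ (iii) every
such pair has finite centraliser» (= `HasIsolatingTwist (SU(N)) z` of the crux line `twisted-slab-continuity`) holds
iff `k` is a unit of `ℤ/N`.  «⇐» is `suCenter_isolatingTwist`; «⇒» is clause (iii) against
`exists_pair_infinite_centralizer_of_not_isUnit` (rank-zero `c`-pairs force `c` to generate); for a non-unit `k`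
clause (ii) fails too (`exists_pairs_not_conj_of_not_isUnit`), clause (i) always holds
(`exists_pair_commutator_eq_suCenter`). [cite: BorelFriedmanMorgan2002, Prop 4.1.1] [cite: Gonzalezarroyo1998, §4.2] -/
theorem suCenter_isolatingTwist_iff [NeZero N] (k : ZMod N) :
    ((∃ A B : Matrix.specialUnitaryGroup (Fin N) ℂ,
        A * B * A⁻¹ * B⁻¹ = (suCenter N k : Matrix.specialUnitaryGroup (Fin N) ℂ)) ∧
      (∀ A B A' B' : Matrix.specialUnitaryGroup (Fin N) ℂ,
        A * B * A⁻¹ * B⁻¹ = (suCenter N k : Matrix.specialUnitaryGroup (Fin N) ℂ) →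
        A' * B' * A'⁻¹ * B'⁻¹ = (suCenter N k : Matrix.specialUnitaryGroup (Fin N) ℂ) →
          ∃ g : Matrix.specialUnitaryGroup (Fin N) ℂ, A' = g * A * g⁻¹ ∧ B' = g * B * g⁻¹) ∧
      (∀ A B : Matrix.specialUnitaryGroup (Fin N) ℂ,
        A * B * A⁻¹ * B⁻¹ = (suCenter N k : Matrix.specialUnitaryGroup (Fin N) ℂ) →
          {g : Matrix.specialUnitaryGroup (Fin N) ℂ | g * A * g⁻¹ = A ∧ g * B * g⁻¹ = B}.Finite)) ↔
      IsUnit k := by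
  refine ⟨fun h => ?_, fun hk => suCenter_isolatingTwist hk⟩
  by_contra hk
  obtain ⟨A, B, hAB, hinf⟩ := exists_pair_infinite_centralizer_of_not_isUnit hk
  exact hinf (h.2.2 A B hAB)

/-- Clause (iii) alone already forces a generator: if EVERY pair with commutator `ω^k·1` has finite centraliser and
one such pair exists, then `k` is a unit of `ℤ/N` («a rank-zero `c`-pair exists only if `c` generates the centre»).
[cite: BorelFriedmanMorgan2002, Prop 4.1.1] -/
theorem isUnit_of_forall_centralizer_finite [NeZero N] {k : ZMod N}
    (h : ∀ A B : Matrix.specialUnitaryGroup (Fin N) ℂ,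
      A * B * A⁻¹ * B⁻¹ = (suCenter N k : Matrix.specialUnitaryGroup (Fin N) ℂ) →
        {g : Matrix.specialUnitaryGroup (Fin N) ℂ | g * A * g⁻¹ = A ∧ g * B * g⁻¹ = B}.Finite) :
    IsUnit k := by
  by_contra hk
  obtain ⟨A, B, hAB, hinf⟩ := exists_pair_infinite_centralizer_of_not_isUnit hk
  exact hinf (h A B hAB)

/-- ★ **Scope of the twisted-box binder at `G = SU(N)`**: an element `z ∈ SU(N)` is CENTRAL and carries an isolating
twist ((i) ∧ (ii) ∧ (iii) above) iff `z = ω^k·1` for a UNIT `k` of `ℤ/N` — the binder «`z ∈ Z(G)`,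
`HasIsolatingTwist G z`» of the anchor `TwistedSlabAnchor` (census row 43) ranges, for `SU(N)`, exactly over the
generators of `Z_N` ('t Hooft's clock–shift twists; Borel–Friedman–Morgan's rank-zero case).
[cite: BorelFriedmanMorgan2002, Prop 4.1.1] [cite: Gonzalezarroyo1998, §4.2] -/
theorem isolating_central_iff [NeZero N] (z : Matrix.specialUnitaryGroup (Fin N) ℂ) :
    (z ∈ Subgroup.center (Matrix.specialUnitaryGroup (Fin N) ℂ) ∧
      (∃ A B : Matrix.specialUnitaryGroup (Fin N) ℂ, A * B * A⁻¹ * B⁻¹ = z) ∧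
      (∀ A B A' B' : Matrix.specialUnitaryGroup (Fin N) ℂ,
        A * B * A⁻¹ * B⁻¹ = z → A' * B' * A'⁻¹ * B'⁻¹ = z →
          ∃ g : Matrix.specialUnitaryGroup (Fin N) ℂ, A' = g * A * g⁻¹ ∧ B' = g * B * g⁻¹) ∧
      (∀ A B : Matrix.specialUnitaryGroup (Fin N) ℂ, A * B * A⁻¹ * B⁻¹ = z →
          {g : Matrix.specialUnitaryGroup (Fin N) ℂ | g * A * g⁻¹ = A ∧ g * B * g⁻¹ = B}.Finite)) ↔
      ∃ k : ZMod N, IsUnit k ∧ z = (suCenter N k : Matrix.specialUnitaryGroup (Fin N) ℂ) := by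
  constructor
  · rintro ⟨hz, h⟩
    obtain ⟨k, rfl⟩ := (mem_center_specialUnitaryGroup_iff z).1 hz
    exact ⟨k, (suCenter_isolatingTwist_iff k).1 h, rfl⟩
  · rintro ⟨k, hk, rfl⟩
    exact ⟨(suCenter N k).2, suCenter_isolatingTwist hk⟩

end Iff

/-! ## §5 Clause (iii′): for a generating twist the centraliser of every pair IS `⟨z⟩ = Z_N`
(Borel–Friedman–Morgan's `Z(x, y) = Z(G)` in the rank-zero case, for `SU(N)`) -/

section Centraliser

/-- ★ **(iii′) for `SU(N)`.**  For a unit `k` of `ℤ/N` and any pair `A, B ∈ SU(N)` with commutator `z = ω^k·1`, the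
simultaneous centraliser `{g | g A g⁻¹ = A, g B g⁻¹ = B}` is EXACTLY the cyclic group `⟨z⟩` (`= Z(SU(N)) = Z_N`:
a centralising `g` is a scalar by irreducibility of the Weyl pair, hence central, hence `ω^j·1 = z^m` since `z`
generates; conversely powers of the central `z` centralise everything) — item «`Z(x, y) = Z(G)`» of the rank-zero
case.  This is the sharpened third clause (iii′) «centraliser `⊆ Subgroup.zpowers z`» proposed for the anchor T1 of
the line `twisted-slab-continuity`; for `SU(N)` with a generating twist it costs nothing.
[cite: BorelFriedmanMorgan2002, Prop 4.1.1] [cite: Gonzalezarroyo1998, §4.2] -/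
theorem centralizer_pair_eq_zpowers_of_isUnit [NeZero N] {k : ZMod N} (hk : IsUnit k)
    {A B : Matrix.specialUnitaryGroup (Fin N) ℂ}
    (h : A * B * A⁻¹ * B⁻¹ = (suCenter N k : Matrix.specialUnitaryGroup (Fin N) ℂ)) :
    {g : Matrix.specialUnitaryGroup (Fin N) ℂ | g * A * g⁻¹ = A ∧ g * B * g⁻¹ = B} =
      (Subgroup.zpowers (suCenter N k : Matrix.specialUnitaryGroup (Fin N) ℂ) :
        Set (Matrix.specialUnitaryGroup (Fin N) ℂ)) := by
  classical
  ext g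
  simp only [Set.mem_setOf_eq, SetLike.mem_coe]
  constructor
  · rintro ⟨hgA, hgB⟩
    -- `g` is a scalar matrix
    have hAB := val_mul_eq_smul_of_commutator_eq h
    have hgA' : (g : Matrix (Fin N) (Fin N) ℂ) * A = (A : Matrix (Fin N) (Fin N) ℂ) * g :=
      congrArg Subtype.val (mul_inv_eq_iff_eq_mul.1 hgA)
    have hgB' : (g : Matrix (Fin N) (Fin N) ℂ) * B = (B : Matrix (Fin N) (Fin N) ℂ) * g :=
      congrArg Subtype.val (mul_inv_eq_iff_eq_mul.1 hgB)
    obtain ⟨c, hc⟩ := exists_eq_smul_one_of_commute_pair (isUnit_val_specialUnitary A)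
      (isUnit_val_specialUnitary B) (isPrimitiveRoot_centerPhase N hk) hAB hgA' hgB'
    -- hence central, hence `ω^j·1`, hence a power of the generating `ω^k·1`
    have hcen : g ∈ Subgroup.center (Matrix.specialUnitaryGroup (Fin N) ℂ) := by
      rw [Subgroup.mem_center_iff]
      intro x
      apply Subtype.ext
      change (x : Matrix (Fin N) (Fin N) ℂ) * g = (g : Matrix (Fin N) (Fin N) ℂ) * x
      rw [hc, Matrix.mul_smul, Matrix.mul_one, Matrix.smul_mul, Matrix.one_mul]
    obtain ⟨j, hj⟩ := (mem_center_specialUnitaryGroup_iff g).1 hcen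
    obtain ⟨m, hm⟩ := exists_suCenter_eq_pow N hk j
    rw [hj, hm, Subgroup.coe_pow]
    exact Subgroup.npow_mem_zpowers _ m
  · intro hg
    obtain ⟨i, rfl⟩ := Subgroup.mem_zpowers_iff.1 hg
    have hz : (suCenter N k : Matrix.specialUnitaryGroup (Fin N) ℂ) ^ i ∈
        Subgroup.center (Matrix.specialUnitaryGroup (Fin N) ℂ) := Subgroup.zpow_mem _ (suCenter N k).2 i
    refine ⟨?_, ?_⟩
    · rw [mul_inv_eq_iff_eq_mul]
      exact ((Subgroup.mem_center_iff.1 hz) A).symm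
    · rw [mul_inv_eq_iff_eq_mul]
      exact ((Subgroup.mem_center_iff.1 hz) B).symm

/-- The centraliser of a generating-twist pair is the centre `Z(SU(N))` («`Z(x, y) = Z(G)`»).
[cite: BorelFriedmanMorgan2002, Prop 4.1.1] -/
theorem centralizer_pair_eq_center_of_isUnit [NeZero N] {k : ZMod N} (hk : IsUnit k)
    {A B : Matrix.specialUnitaryGroup (Fin N) ℂ}
    (h : A * B * A⁻¹ * B⁻¹ = (suCenter N k : Matrix.specialUnitaryGroup (Fin N) ℂ)) :
    {g : Matrix.specialUnitaryGroup (Fin N) ℂ | g * A * g⁻¹ = A ∧ g * B * g⁻¹ = B} =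
      (Subgroup.center (Matrix.specialUnitaryGroup (Fin N) ℂ) : Set (Matrix.specialUnitaryGroup (Fin N) ℂ)) := by
  rw [centralizer_pair_eq_zpowers_of_isUnit hk h]
  ext g
  simp only [SetLike.mem_coe]
  constructor
  · intro hg
    obtain ⟨i, rfl⟩ := Subgroup.mem_zpowers_iff.1 hg
    exact Subgroup.zpow_mem _ (suCenter N k).2 i
  · intro hg
    obtain ⟨j, hj⟩ := (mem_center_specialUnitaryGroup_iff g).1 hg
    obtain ⟨m, hm⟩ := exists_suCenter_eq_pow N hk j
    rw [hj, hm, Subgroup.coe_pow]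
    exact Subgroup.npow_mem_zpowers _ m

/-- The twist `ω^k·1` has finite order (`z^N = 1`), so `⟨z⟩` is finite: clause (iii′) implies clause (iii).
[cite: tHooft1979Flux, §2 (2.2)] -/
theorem zpowers_suCenter_finite [NeZero N] (k : ZMod N) :
    (Subgroup.zpowers (suCenter N k : Matrix.specialUnitaryGroup (Fin N) ℂ) :
      Set (Matrix.specialUnitaryGroup (Fin N) ℂ)).Finite := by
  refine (isOfFinOrder_iff_pow_eq_one.2 ⟨N, Nat.pos_of_ne_zero (NeZero.ne N), ?_⟩).finite_zpowers
  rw [← Subgroup.coe_pow, suCenter_pow_card, Subgroup.coe_one]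

/-- ★ **The isolating-twist package with the sharpened clause (iii′)**: for `z = ω^k·1 ∈ SU(N)`,
«(i) `z` is a commutator ∧ (ii) all pairs with commutator `z` are simultaneously conjugate ∧ (iii′) the simultaneous
centraliser of every such pair is contained in `⟨z⟩`» holds iff `k` is a unit of `ℤ/N` — (iii′) ⇒ (iii) because
`⟨z⟩` is finite, and for a unit `k` (iii′) is `centralizer_pair_eq_zpowers_of_isUnit`.  (The reshaped hypothesis
`HasIsolatingTwist` with (iii′) in place of (iii) is therefore met by `SU(N)` with a generating twist and by nothing
else among the `ω^k·1`.) [cite: BorelFriedmanMorgan2002, Prop 4.1.1] [cite: Gonzalezarroyo1998, §4.2] -/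
theorem suCenter_isolatingTwist_zpowers_iff [NeZero N] (k : ZMod N) :
    ((∃ A B : Matrix.specialUnitaryGroup (Fin N) ℂ,
        A * B * A⁻¹ * B⁻¹ = (suCenter N k : Matrix.specialUnitaryGroup (Fin N) ℂ)) ∧
      (∀ A B A' B' : Matrix.specialUnitaryGroup (Fin N) ℂ,
        A * B * A⁻¹ * B⁻¹ = (suCenter N k : Matrix.specialUnitaryGroup (Fin N) ℂ) →
        A' * B' * A'⁻¹ * B'⁻¹ = (suCenter N k : Matrix.specialUnitaryGroup (Fin N) ℂ) →
          ∃ g : Matrix.specialUnitaryGroup (Fin N) ℂ, A' = g * A * g⁻¹ ∧ B' = g * B * g⁻¹) ∧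
      (∀ A B : Matrix.specialUnitaryGroup (Fin N) ℂ,
        A * B * A⁻¹ * B⁻¹ = (suCenter N k : Matrix.specialUnitaryGroup (Fin N) ℂ) →
          {g : Matrix.specialUnitaryGroup (Fin N) ℂ | g * A * g⁻¹ = A ∧ g * B * g⁻¹ = B} ⊆
            (Subgroup.zpowers (suCenter N k : Matrix.specialUnitaryGroup (Fin N) ℂ) :
              Set (Matrix.specialUnitaryGroup (Fin N) ℂ)))) ↔
      IsUnit k := by
  refine ⟨fun h => ?_, fun hk => ?_⟩
  · exact isUnit_of_forall_centralizer_finite fun A B hAB => (zpowers_suCenter_finite k).subset (h.2.2 A B hAB)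
  · obtain ⟨h1, h2, -⟩ := suCenter_isolatingTwist hk
    exact ⟨h1, h2, fun A B hAB => (centralizer_pair_eq_zpowers_of_isUnit hk hAB).le⟩

end Centraliser

end Literature.MathematicalPhysics.QuantumLattice

end
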